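import Summits.RiemannHypothesis.RiemannHypothesis.Theorems.PfPersistenceM2EvenSectorMultiplier
import Literature.NumberTheory.LFunctions.WeilLineZerosDensity
import Literature.NumberTheory.LFunctions.SimpleZeros
import Literature.NumberTheory.LFunctions.ZeroCountingProofs
import Mathlib.Analysis.Complex.JensenFormula
import HarnessLib

/-!
# Even sector of the Pf-persistence index route (M2): the annihilation mechanism stops at `θ = 0`

Long-odds MECHANISM SEARCH (cell `pub-rhpf`, seat M2); every result here is RH-free and makes
no claim about RH.

The files `PfPersistenceM2EvenSectorCosineProduct`, `…ZeroDensity`, `…SummableMultiplier` show that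
for every `θ > 0` the quadrant `𝒵_θ = {ρ : ζ(ρ) = 0 nontrivial, Re ρ ≥ 1/2 + θ, Im ρ > 0}` is
annihilated by ONE even real Weil test function (`QuadrantMultiplier θ`), conditionally on the
named zero-density fact `zeroDensity_ingham`.  This file records the complementary NO-GO at the
endpoint `θ = 0` (the level that is equivalent to RH on the index ladder):

* `finsetCard_zeros_le_jensen` — Jensen's inequality in counting form: an analytic `f` on
  `|z - c| ≤ R` with `f c ≠ 0` and `‖f‖ ≤ M` on `|z - c| = R` has at most
  `log (M / ‖f c‖) / log (R / r)` zeros (distinct points) in `|z - c| ≤ r`.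
* (from the tree, by name) `Literature.NumberTheory.LFunctions.norm_weilMellin_le_exp_mul_integral_norm`
  — a test function supported in `[-b, b]` has a Mellin transform of exponential type:
  `‖φ̂(s)‖ ≤ e^{b |Re s - 1/2|} ∫ ‖φ‖` (`WeilLineZerosDensity.lean`).
* `eventually_linear_le_zetaZeroCount_third` — from the Riemann–von Mangoldt formula (named fact
  `riemann_von_mangoldt`): `A T + B ≤ N(T)/3` for all large `T`, for any constants `A, B`.
* `weilMellin_eq_zero_of_vanish_simpleCritical` — MAIN: given the named facts
  `riemann_von_mangoldt` (Titchmarsh Thm 9.4) and `Anderson1983_levinson_simple` (Levinson 1974 /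
  Heath-Brown 1979 / Anderson 1983, Titchmarsh §10.29 (10.29.1): at least `0.3532 N(T)` zeros are
  simple and on the critical line), a Weil test function whose Mellin transform vanishes at every
  SIMPLE critical zero `1/2 + iγ`, `γ > 0`, has identically vanishing Mellin transform.  Reason: the
  simple critical zeros up to height `T` are `≥ N(T)/3 ≫ T log T` distinct points of the disc
  `|s - c| ≤ T + ‖c‖ + 1`, while Jensen allows the entire function `φ̂` of exponential type only
  `O(T)` zeros there.
* `not_quadrantMultiplier_zero`, `not_quadrantMultiplier_of_nonpos` — hence `QuadrantMultiplier 0`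
  (and every `QuadrantMultiplier θ`, `θ ≤ 0`) is FALSE under the two named facts: the multiplier /
  annihilation mechanism that settles every level `θ > 0` provably cannot reach the closed
  quadrant `Re ρ ≥ 1/2`.

Both hypotheses are pre-existing CITED named facts of the Literature tree, consumed by name;
nothing is minted here.
-/

open Complex Filter Set MeasureTheory Metric MeromorphicOn
open scoped Real Topology

namespace Summit.RiemannHypothesis.RiemannHypothesis.Theorems.PfPersistenceM2NegIndex

open Literature.NumberTheory.LFunctions
open Literature.NumberTheory.LFunctions.ZetaZeros

/-! ## Jensen's inequality, counting form -/

/-- **Jensen's inequality, counting form.** If `f` is analytic on the closed disc `|z - c| ≤ R`,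
`f c ≠ 0`, `‖f z‖ ≤ M` (`M ≥ 1`) on the circle `|z - c| = R`, and `0 < r < R`, then any finite set
of zeros of `f` in the disc `|z - c| ≤ r` has at most `log (M / ‖f c‖) / log (R / r)` elements
(each zero carries divisor `≥ 1`, and the total divisor is bounded by Mathlib's
`AnalyticOnNhd.sum_divisor_le`). [folklore] -/
theorem finsetCard_zeros_le_jensen {f : ℂ → ℂ} {c : ℂ} {r R M : ℝ} (hr : 0 < r) (hrR : r < R)
    (hM : 1 ≤ M) (hf : AnalyticOnNhd ℂ f (closedBall c R))
    (hfM : ∀ z ∈ sphere c R, ‖f z‖ ≤ M) (hc : f c ≠ 0) (Z : Finset ℂ)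
    (hZ : ∀ u ∈ Z, u ∈ closedBall c r ∧ f u = 0) :
    (Z.card : ℝ) ≤ Real.log (M / ‖f c‖) / Real.log (R / r) := by
  have hR : 0 < R := hr.trans hrR
  have hf' : AnalyticOnNhd ℂ f (closedBall c |R|) := by rwa [abs_of_pos hR]
  have hfM' : ∀ z ∈ sphere c |R|, ‖f z‖ ≤ M := by rwa [abs_of_pos hR]
  have hJ := AnalyticOnNhd.sum_divisor_le (f := f) (c := c) (r := r) (R := R)
    (by rwa [abs_of_pos hr]) (by rwa [abs_of_pos hr, abs_of_pos hR]) hM hf' hc hfM'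
  rw [abs_of_pos hr] at hJ
  refine le_trans ?_ hJ
  set U := closedBall c r with hU
  have hfU : AnalyticOnNhd ℂ f U := fun z hz ↦ hf z (closedBall_subset_closedBall hrR.le hz)
  have hmer : MeromorphicOn f U := hfU.meromorphicOn
  set D := divisor f U with hD
  have hfin : (Function.support fun u ↦ (D u : ℝ)).Finite := by
    refine (D.finiteSupport (isCompact_closedBall _ _)).subset fun u hu ↦ ?_
    simpa using hu
  have hcast : ((∑ᶠ u, D u : ℤ) : ℝ) = ∑ᶠ u, (D u : ℝ) :=
    map_finsum (Int.castRingHom ℝ) (D.finiteSupport (isCompact_closedBall _ _))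
  rw [hcast, finsum_eq_sum_of_support_subset _ (s := hfin.toFinset) (by simp)]
  -- the divisor at a zero `x ∈ Z` is `≥ 1`
  have hDx : ∀ x ∈ Z, (1 : ℝ) ≤ D x := by
    intro x hx
    obtain ⟨hxU, hfx⟩ := hZ x hx
    rw [hD, divisor_apply hmer hxU]
    have han : AnalyticAt ℂ f x := hfU x hxU
    have hne_top : analyticOrderAt f x ≠ ⊤ := by
      intro htop
      rw [analyticOrderAt_eq_top] at htop
      have hpre : IsPreconnected U := (convex_closedBall c r).isPreconnected
      have hcU : c ∈ U := mem_closedBall_self hr.le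
      exact hc (hfU.eqOn_zero_of_preconnected_of_eventuallyEq_zero hpre hxU htop hcU)
    have hpos : 0 < analyticOrderAt f x := by
      rw [pos_iff_ne_zero, Ne, han.analyticOrderAt_eq_zero]
      exact not_not.2 hfx
    obtain ⟨n, hn⟩ := ENat.ne_top_iff_exists.mp hne_top
    rw [← hn] at hpos
    have hn1 : 1 ≤ n := Nat.one_le_iff_ne_zero.2 (by rintro rfl; simp at hpos)
    rw [han.meromorphicOrderAt_eq, ← hn, ENat.map_coe, WithTop.untop₀_coe]
    exact_mod_cast hn1
  have hsub : Z ⊆ hfin.toFinset := by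
    intro u hu
    rw [Set.Finite.mem_toFinset, Function.mem_support]
    linarith [hDx u hu]
  calc (Z.card : ℝ) = ∑ x ∈ Z, (1 : ℝ) := by simp
    _ ≤ ∑ x ∈ Z, (D x : ℝ) := Finset.sum_le_sum hDx
    _ ≤ ∑ u ∈ hfin.toFinset, (D u : ℝ) :=
        Finset.sum_le_sum_of_subset_of_nonneg hsub fun u _ _ ↦ by
          exact_mod_cast hfU.divisor_nonneg u

/-! ## A superlinear lower bound for `N(T)` from the Riemann–von Mangoldt formula -/

/-- From `N(T) = (T/2π) log (T/2π) - T/2π + O(log T)` (named fact `riemann_von_mangoldt`): for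
any constants `A, B`, eventually `A T + B ≤ N(T) / 3` (indeed `N(T)/T → ∞`).
[cite: Titchmarsh1986, Thm. 9.4] -/
theorem eventually_linear_le_zetaZeroCount_third (h : riemann_von_mangoldt) (A B : ℝ) :
    ∀ᶠ T : ℝ in atTop, A * T + B ≤ (zetaZeroCount T : ℝ) / 3 := by
  obtain ⟨C₀, hC₀, hbd⟩ := h.exists_pos
  have h2 : ∀ᶠ T : ℝ in atTop, 1 + 2 * π * (3 * |A| + 2) ≤ Real.log (T / (2 * π)) :=
    (Real.tendsto_log_atTop.comp (tendsto_id.atTop_div_const (by positivity))).eventually_ge_atTop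
      _
  have h3 : ∀ᶠ T : ℝ in atTop, ‖Real.log T‖ ≤ (1 / C₀) * ‖T‖ :=
    Real.isLittleO_log_id_atTop.def (by positivity)
  filter_upwards [hbd.bound, h2, h3, eventually_ge_atTop (1 : ℝ),
    eventually_ge_atTop (3 * |B|)] with T hb h2 h3 h1 hB
  rw [Real.norm_of_nonneg (Real.log_nonneg h1)] at hb h3
  rw [Real.norm_of_nonneg (by linarith : (0 : ℝ) ≤ T)] at h3
  rw [Real.norm_eq_abs] at hb
  have hb' := (abs_le.1 hb).1
  have h4 : T / (2 * π) * (1 + 2 * π * (3 * |A| + 2)) ≤ T / (2 * π) * Real.log (T / (2 * π)) :=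
    mul_le_mul_of_nonneg_left h2 (by positivity)
  have h5 : C₀ * Real.log T ≤ T := by
    calc C₀ * Real.log T ≤ C₀ * ((1 / C₀) * T) := mul_le_mul_of_nonneg_left h3 hC₀.le
      _ = T := by field_simp
  have h6 : T / (2 * π) * (1 + 2 * π * (3 * |A| + 2)) = T / (2 * π) + (3 * |A| + 2) * T := by
    field_simp
  rw [h6] at h4
  have hA : A * T ≤ |A| * T := mul_le_mul_of_nonneg_right (le_abs_self A) (by linarith)
  have hB' : B ≤ |B| := le_abs_self B
  rw [le_div_iff₀ (by norm_num : (0 : ℝ) < 3)]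
  linarith

/-! ## The main theorem: no test function annihilates the simple critical zeros -/

/-- The simple zeros of `ζ` on the critical segment `1/2 + it`, `0 < t ≤ T`, as a finite set; its
cardinality is `simpleCriticalZeroCount T`. [folklore] -/
theorem simpleCriticalZeros_finite (T : ℝ) :
    {ρ ∈ zetaZeroBox (1 / 2) T | ρ.re = 1 / 2 ∧ riemannZetaZeroOrder ρ = 1}.Finite :=
  (zetaZeroBox_finite _ _).subset (sep_subset _ _)

/-- **Main theorem (no annihilator of the simple critical zeros).** Assume the named facts
`riemann_von_mangoldt` (Riemann–von Mangoldt formula, Titchmarsh Thm 9.4) and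
`Anderson1983_levinson_simple` (Levinson–Heath-Brown–Anderson: `≥ 0.3532 N(T)` zeros are simple
and critical, Titchmarsh §10.29).  If `φ` is a Weil test function (smooth, compact support) whose
Mellin transform `φ̂` vanishes at every simple zero `ρ = 1/2 + iγ`, `γ > 0`, of `ζ`, then `φ̂ ≡ 0`.
Proof: otherwise pick `c` with `φ̂(c) ≠ 0`; `φ̂` is entire of exponential type
(`norm_weilMellin_le_exp_mul_integral_norm`),
so Jensen (`finsetCard_zeros_le_jensen`, radii `r = T + ‖c‖ + 1`, `R = e r`) bounds the number of
simple critical zeros up to height `T` by `A T + B`; but that number is `≥ N(T)/3`, and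
`eventually_linear_le_zetaZeroCount_third` gives `A T + B + 1 ≤ N(T)/3` for large `T`.
[cite: Titchmarsh1986, §10.29] -/
theorem weilMellin_eq_zero_of_vanish_simpleCritical (h₁ : riemann_von_mangoldt)
    (h₂ : Anderson1983_levinson_simple) {φ : ℝ → ℂ} (hφ : IsWeilTest φ)
    (hvan : ∀ ρ : ℂ, riemannZeta ρ = 0 → ρ.re = 1 / 2 → 0 < ρ.im → riemannZetaZeroOrder ρ = 1 →
      weilMellin φ ρ = 0) :
    weilMellin φ = 0 := by
  by_contra hne
  obtain ⟨c, hc⟩ : ∃ c, weilMellin φ c ≠ 0 := by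
    by_contra! h
    exact hne (funext h)
  -- a symmetric interval containing the support
  obtain ⟨b, hb0, hsupp⟩ : ∃ b : ℝ, 0 ≤ b ∧ tsupport φ ⊆ Icc (-b) b := by
    obtain ⟨b, hb⟩ := hφ.2.isCompact.isBounded.subset_closedBall 0
    refine ⟨|b|, abs_nonneg b, fun t ht ↦ ?_⟩
    have h := hb ht
    rw [mem_closedBall, dist_zero_right, Real.norm_eq_abs] at h
    have h' : |t| ≤ |b| := h.trans (le_abs_self b)
    exact ⟨by linarith [(abs_le.1 h').1], (abs_le.1 h').2⟩
  set F := weilMellin φ with hF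
  set L := ∫ t, ‖φ t‖ with hL
  have hL0 : 0 ≤ L := integral_nonneg fun _ ↦ norm_nonneg _
  have hFan : AnalyticOnNhd ℂ F univ := analyticOnNhd_weilMellin hφ.1.continuous hφ.2 univ
  -- the constants of the linear Jensen bound
  set L' := Real.log (max L 1) with hL'
  have hL'0 : 0 ≤ L' := Real.log_nonneg (le_max_right _ _)
  set A := b * Real.exp 1 with hA
  set B := b * (Real.exp 1 * (‖c‖ + 1) + ‖c‖ + 1) + L' - Real.log ‖F c‖ with hB
  -- Jensen: for every `T ≥ 1`, `#{simple critical zeros ≤ T} ≤ A T + B`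
  have hJ : ∀ T : ℝ, 1 ≤ T → (simpleCriticalZeroCount T : ℝ) ≤ A * T + B := by
    intro T hT
    set r := T + ‖c‖ + 1 with hr
    have hr0 : 0 < r := by positivity
    set R := Real.exp 1 * r with hRdef
    have he : 1 < Real.exp 1 := Real.one_lt_exp_iff.2 one_pos
    have hrR : r < R := by rw [hRdef]; exact lt_mul_left hr0 he
    set κ := b * (R + ‖c‖ + 1) with hκ
    have hκ0 : 0 ≤ κ := by positivity
    set M := Real.exp κ * max L 1 with hMdef
    have hM1 : 1 ≤ M := by
      rw [hMdef]
      nlinarith [Real.one_le_exp_iff.2 hκ0, le_max_right L 1, (Real.exp_pos κ).le]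
    -- the bound on the circle `|z - c| = R`
    have hFM : ∀ z ∈ sphere c R, ‖F z‖ ≤ M := by
      intro z hz
      rw [mem_sphere, dist_eq_norm] at hz
      have h1 := norm_weilMellin_le_exp_mul_integral_norm hφ.1.continuous hφ.2 hsupp z
      have hzre : |z.re - 1 / 2| ≤ R + ‖c‖ + 1 := by
        have e1 : |z.re - c.re| ≤ ‖z - c‖ := by
          rw [← sub_re]
          exact abs_re_le_norm (z - c)
        have e2 : |c.re| ≤ ‖c‖ := abs_re_le_norm c
        have e3 : |z.re - 1 / 2| ≤ |z.re - c.re| + |c.re| + 1 / 2 := by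
          have t1 : |z.re - 1 / 2| ≤ |z.re - c.re| + |c.re - 1 / 2| := abs_sub_le _ _ _
          have t2 : |c.re - 1 / 2| ≤ |c.re| + |(1 / 2 : ℝ)| := abs_sub _ _
          have t3 : |(1 / 2 : ℝ)| = 1 / 2 := by norm_num
          linarith
        linarith
      calc ‖F z‖ ≤ Real.exp (b * |z.re - 1 / 2|) * L := h1
        _ ≤ Real.exp κ * L := by
            gcongr
            calc b * |z.re - 1 / 2| ≤ b * (R + ‖c‖ + 1) := mul_le_mul_of_nonneg_left hzre hb0
              _ = κ := by rw [hκ]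
        _ ≤ M := by rw [hMdef]; gcongr; exact le_max_left _ _
    -- the simple critical zeros up to `T` as a finite set of zeros of `F` in `|z - c| ≤ r`
    set S := {ρ ∈ zetaZeroBox (1 / 2) T | ρ.re = 1 / 2 ∧ riemannZetaZeroOrder ρ = 1} with hS
    have hSf : S.Finite := simpleCriticalZeros_finite T
    have hZ : ∀ u ∈ hSf.toFinset, u ∈ closedBall c r ∧ F u = 0 := by
      intro u hu
      rw [Finite.mem_toFinset] at hu
      obtain ⟨⟨h0, -, -, him, hT'⟩, hre, hord⟩ := hu
      refine ⟨?_, hvan u h0 hre him hord⟩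
      rw [mem_closedBall, dist_eq_norm]
      have hu1 : ‖u‖ ≤ |u.re| + |u.im| := norm_le_abs_re_add_abs_im u
      rw [hre, abs_of_pos him] at hu1
      calc ‖u - c‖ ≤ ‖u‖ + ‖c‖ := norm_sub_le _ _
        _ ≤ r := by rw [hr]; norm_num at hu1 ⊢; linarith
    have hcard := finsetCard_zeros_le_jensen hr0 hrR hM1 (hFan.mono (subset_univ _)) hFM hc
      hSf.toFinset hZ
    have hRr : R / r = Real.exp 1 := by rw [hRdef]; field_simp
    rw [hRr, Real.log_exp, div_one, Real.log_div (by positivity) (norm_ne_zero_iff.2 hc),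
      hMdef, Real.log_mul (Real.exp_pos κ).ne' (by positivity), Real.log_exp] at hcard
    have hncard : (simpleCriticalZeroCount T : ℝ) = hSf.toFinset.card := by
      rw [simpleCriticalZeroCount, ← hS, ncard_eq_toFinset_card S hSf]
    rw [hncard]
    calc (hSf.toFinset.card : ℝ) ≤ κ + L' - Real.log ‖F c‖ := hcard
      _ = A * T + B := by rw [hκ, hRdef, hr, hA, hB]; ring
  -- the facts: `N(T)/3 ≤ #{simple critical zeros ≤ T}` and `A T + B + 1 ≤ N(T)/3` eventually
  obtain ⟨T₀, hT₀⟩ := h₂.third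
  have hev := eventually_linear_le_zetaZeroCount_third h₁ A (B + 1)
  obtain ⟨T, hT, hT1⟩ := (hev.and (eventually_ge_atTop (max T₀ 1))).exists
  have hge := hT₀ T ((le_max_left _ _).trans hT1)
  have hle := hJ T ((le_max_right _ _).trans hT1)
  linarith

/-! ## Corollaries for the multiplier ladder -/

/-- Under the two named facts there is a zero of `ζ` on the critical line with positive
ordinate which is simple; in particular the closed quadrant `𝒵_0` is non-empty.
[cite: Titchmarsh1986, §10.29] -/
theorem exists_simpleCriticalZero (h₁ : riemann_von_mangoldt) (h₂ : Anderson1983_levinson_simple) :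
    ∃ ρ : ℂ, riemannZeta ρ = 0 ∧ ρ.re = 1 / 2 ∧ 0 < ρ.im ∧ riemannZetaZeroOrder ρ = 1 := by
  obtain ⟨T₀, hT₀⟩ := h₂.third
  obtain ⟨T, hT, hT1⟩ := (h₁.eventually_self_le.and (eventually_ge_atTop (max T₀ 3))).exists
  have hge := hT₀ T ((le_max_left _ _).trans hT1)
  have h3 : (3 : ℝ) ≤ T := (le_max_right _ _).trans hT1
  have hpos : (0 : ℝ) < simpleCriticalZeroCount T := by linarith
  have hne : {ρ ∈ zetaZeroBox (1 / 2) T | ρ.re = 1 / 2 ∧ riemannZetaZeroOrder ρ = 1}.Nonempty := by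
    apply nonempty_of_ncard_ne_zero
    rw [← simpleCriticalZeroCount]
    exact_mod_cast hpos.ne'
  obtain ⟨ρ, ⟨h0, -, -, him, -⟩, hre, hord⟩ := hne
  exact ⟨ρ, h0, hre, him, hord⟩

/-- **Level-zero no-go.** Under the named facts `riemann_von_mangoldt` and
`Anderson1983_levinson_simple`, `QuadrantMultiplier 0` is false: no non-zero even real Weil test
function has Mellin transform vanishing at every nontrivial zero with `Re ρ ≥ 1/2`, `Im ρ > 0`
(indeed none — even, real or not — vanishes at all the simple critical zeros,
`weilMellin_eq_zero_of_vanish_simpleCritical`).  The annihilation mechanism behind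
`quadrantMultiplier_of_ingham` (every `θ > 0`) therefore stops exactly at the RH-equivalent
level `θ = 0`. [cite: Titchmarsh1986, §10.29] -/
theorem not_quadrantMultiplier_zero (h₁ : riemann_von_mangoldt)
    (h₂ : Anderson1983_levinson_simple) : ¬ QuadrantMultiplier 0 := by
  intro hQ
  obtain ⟨ρ₀, h0, hre, him, -⟩ := exists_simpleCriticalZero h₁ h₂
  have hmem : ∀ ρ : ℂ, riemannZeta ρ = 0 → ρ.re = 1 / 2 → 0 < ρ.im →
      ρ ∈ {ρ : ℂ | ρ ∈ riemannZetaNontrivialZeros ∧ 1 / 2 + (0 : ℝ) ≤ ρ.re ∧ 0 < ρ.im} := by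
    intro ρ h0 hre him
    refine ⟨zetaZeroBox_subset_riemannZetaNontrivialZeros (1 / 2) ρ.im
      ⟨h0, hre.ge, by rw [hre]; norm_num, him, le_rfl⟩, by rw [hre]; norm_num, him⟩
  obtain ⟨φ, b, hφ, -, -, -, hne, hv⟩ := hQ ⟨ρ₀, hmem ρ₀ h0 hre him⟩
  exact hne (weilMellin_eq_zero_of_vanish_simpleCritical h₁ h₂ hφ
    fun ρ h0 hre him _ ↦ hv ρ (hmem ρ h0 hre him))

/-- Every level `θ ≤ 0` of the multiplier ladder is false under the two named facts
(`QuadrantMultiplier` is monotone in `θ`). [cite: Titchmarsh1986, §10.29] -/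
theorem not_quadrantMultiplier_of_nonpos (h₁ : riemann_von_mangoldt)
    (h₂ : Anderson1983_levinson_simple) {θ : ℝ} (hθ : θ ≤ 0) : ¬ QuadrantMultiplier θ :=
  fun h ↦ not_quadrantMultiplier_zero h₁ h₂ (h.mono hθ)

end Summit.RiemannHypothesis.RiemannHypothesis.Theorems.PfPersistenceM2NegIndex
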